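import Literature.NumberTheory.LFunctions.MatomakiRadziwillTaoTheoremA2
import Literature.NumberTheory.LFunctions.MatomakiRadziwillTaoParseval
import Literature.Barriers.Parity.ElliottOriginalForm
import HarnessLib

/-!
# Matomäki–Radziwiłł–Tao 2015, Appendix A: Proposition A.3 (named fact) and Theorem A.2 from it

Topic `Literature/NumberTheory/LFunctions`.  K. Matomäki, M. Radziwiłł, T. Tao, *An averaged form of
Chowla's conjecture*, Algebra & Number Theory **9** (2015), Appendix A ("Mean values of complex
multiplicative functions in short intervals"; arXiv:1503.05121 §6).  The appendix proves the complex
Matomäki–Radziwiłł theorem (Theorem A.2, the tree's named fact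
`Literature.NumberTheory.LFunctions.MatomakiRadziwillTao2015_theoremA2`, on which the major-arc estimate
`MatomakiRadziwillTaoMajorArc.lean` and hence MRT Theorem 1.7 and Tao 2016 rest) in two steps: a Parseval
bound, and "Theorem A.2 now follows immediately from the following variant of [MR]: Proposition A.3".
This file carries out exactly that deduction:

* `Literature.NumberTheory.LFunctions.MatomakiRadziwillTao2015_propA3` — NAMED FACT, Proposition A.3 as
  printed (the one-sided mean value `∫_0^T |F(1+it)|² dt` of
  `F(s) = ∑_{X ≤ n ≤ 2X, n ∈ 𝒮} f(n) n^{-s}`, `MRT2015.restrDirichlet`), with the error terms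
  `MRT2015.errA3 = (log Q₁)^{1/3}/P₁^{1/6-η} + (1+M)e^{-M} + (log X)^{-1/50}`;
* `Literature.NumberTheory.LFunctions.MRT2015.propA3_twoSided` — PROVED: the bound for
  `∫_0^T (|F(1+it)|² + |F(1-it)|²) dt` (constant `2C`), by applying the fact to `f` and to `conj ∘ f`
  (`conjFun`: same `𝒮`, `M(conj f; X) = M(f; X)` (`minPretentiousDistSq_conjFun`),
  `|F_{conj f}(1+it)| = |F_f(1-it)|` (`norm_restrDirichlet_conjFun`)) — this two-sided form is what a
  complex sequence needs on the frequency side;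
* `Literature.NumberTheory.LFunctions.MRT2015.theoremA2_core` — PROVED: Theorem A.2 for `1 ≤ h ≤ X` from
  the Parseval bound `MRT2015.Parseval.meanSquare_shortAvg_le` (`MatomakiRadziwillTaoParseval.lean`) applied
  to `a_n = f(n) 1_𝒮(n)` (`shortSumA2_eq_sum_filter`, `Apoly_eq_restrDirichlet`), the two mean values being
  `∫_0^{X/h} B ≤ 2C₃(Q₁/h + 1)E ≤ 4C₃E` and `sup_{T ≥ X/h} (X/h)/T ∫_T^{2T} B ≤ 2C₃(2Q₁/h + (X/h)/T)E ≤ 6C₃E`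
  (`Q₁ ≤ h`);
* `Literature.NumberTheory.LFunctions.MatomakiRadziwillTao2015_theoremA2_of_propA3` — PROVED:
  `MatomakiRadziwillTao2015_propA3 → MatomakiRadziwillTao2015_theoremA2` (for `h > X` the restricted window
  sum equals the one with `h = X`, `shortSumA2_of_le`, and `Q₁ ≤ exp(√(log X₀)) ≤ X`).

Consequently the named-fact frontier below Theorem A.2 (and, through the sibling files, below
`MatomakiRadziwillTao2015_theorem17` and `tao_log_chowla_two`) is Proposition A.3.

## On the printed proof of Proposition A.3 (what is NOT here)

The appendix proves A.3 "as the proof of [MR 2016, Proposition 1]", replacing MR's Lemma 3 by Lemma A.4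
and the range `[(log X)^{1/15}, T]` by `𝒯₂ = {|t - t₁| ≥ (log X)^{1/16}}` (`t₁` the minimiser of
`𝔻(f, n^{it}; X)`), and bounding `𝒯₀ ∪ 𝒯₁` pointwise by Halász's theorem.  Two points of that sketch need
genuine work for the `𝒮`-RESTRICTED polynomial `F` and are recorded here for whoever discharges the fact:
(i) the pointwise Halász bounds for `F` and for the polynomials `R_{v,H}` of MR §8.3 go through MR's
Lemma 5 (inclusion–exclusion over the `2^J` functions `f g_𝒥`); for real `f` MR's Lemma 2 is uniform in
the function, but for complex `f` the minimisers `t₁(f g_𝒥)` differ from `t₁(f)` and removing the primes of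
`⋃_{j ∈ 𝒥} [P_j, Q_j]` can halve the pretentious distance
(`𝔻(f g_𝒥, p^{iu})² ≥ max(K_𝒥, 𝔻(f, p^{iu})² - K_𝒥)`, `K_𝒥 = ∑_{p ∈ ⋃[P_j,Q_j]} 1/p`, which is not small
for deep interval systems); (ii) near `t₁` the printed pointwise bound `F(1+it) ≪ e^{-M} M` fails for
restricted sums (it holds with `e^{-M/2}`), and the `L²` statement relies on the decay in `|t - t₁|`
(Granville–Soundararajan untwisting).  Matomäki–Radziwiłł, *Multiplicative functions in short intervals
II* (arXiv:2007.04290) treat complex `f` with twists in full.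

## Status of the named fact (D-0026 review of 2026-08-15; no declaration of this file is changed)

`MatomakiRadziwillTao2015_propA3` is Proposition A.3 AS PRINTED, and it is not dischargeable from the
printed proof.  The step "the estimate `F(1+it) ≪ exp(-M(f;X)) M(f;X)` coming from Halasz's theorem for
`t ∈ 𝒯₀`" (arXiv:1503.05121, proof of Proposition 6.3 = A.3) treats the `𝒮`-restricted `F` as an
unrestricted sum.  For restricted sums that pointwise bound fails — one block `E`, `f = n^{it₁}` off `E` and
`-n^{it₁}` on `E`: `M = 2 ∑_{p ∈ E} 1/p` while `|F(1+it₁)| ≍ e^{-M/2}` (see (i), (ii) above and the module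
docstrings of `TwistedPrimeSumTail.lean`, "Remark on the regions `𝒯₀ ∪ 𝒯₁`", and
`MatomakiRadziwillTaoSiftedDistance.lean`, "Status"); the published sifted Halász theorem carries
`M e^{-M/2}`, the full `M` only when `∑_{p ∈ 𝒫} 1/p = O(1)` [cite: MatomakiRadziwill2020ShortIntervalsII, Lemma 5.3];
and Halász's linear factor in `M` cannot be dropped in general [cite: GranvilleSoundararajan2003, Corollary 1]
(ibid. §10b).  An `L²` treatment of the window `|t - t₁| ≤ (log X)^{1/16}` therefore yields middle terms of the
shape `(1 + M) e^{-M/2}` (pointwise restricted Halász, `HalaszRestrictedWindow.lean`) or `(1 + M)² e^{-M}`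
(Gallagher's lemma with a short-interval restricted Halász theorem, `HalaszRestrictedShort*.lean`), not the
printed `(1 + M) e^{-M}`; whether the printed `L²` bound itself holds is not settled by any source known to this
library.  The same applies verbatim to Theorem A.2 as printed (`MatomakiRadziwillTao2015_theoremA2`), whose
proof is the Parseval bound plus Proposition A.3.

Corrected forms live in the hypothesis schemas `MRT2015.PropA3With mid` (`MatomakiRadziwillTaoPropA3With.lean`)
and `MRT2015.TheoremA2With mid`, which introduce no named fact.  PROVED: `MRT2015.propA3With_exp_half_of_vk`
(`MatomakiRadziwillTaoT2OfVK.lean`) — `∃ K ≥ 0, PropA3With (fun M => K (1 + M) e^{-M/2})` from any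
Vinogradov–Korobov zero-free region `HasVKZeroFreeRegion cVK TVK`, `cVK > 0` — and, from it in the same file,
`Tao2016_prop24_of_vk`, `Tao2016_theorem23_of_vk`, `tao_log_averaged_elliott_two_of_vk`,
`tao_log_chowla_two_of_vk`, `tao_log_chowla_liouville_of_vk`, `tao_log_chowla_moebius_of_vk`; the tree proves
such a region from Vinogradov's mean value theorem (`exists_vmvtBound`, `VinogradovMeanValueTheorem.lean`;
`VinogradovZetaSum.hasVKZeroFreeRegion_of_vmvtBound`, `VinogradovZetaSum.lean`, or
`VKZeta.hasVKZeroFreeRegion_of_vmvt`, `VinogradovZetaSumEstimate.lean`).  Matomäki–Radziwiłł–Tao's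
Theorem 1.7 with the printed rate `e^{-M/20}` needs an instance with `mid M ≤ K (1 + M)² e^{-M}`
(`MRT2015.theorem17_of_propA3With_sq`, `MatomakiRadziwillTaoTheorem17OfA2WithSq.lean`); with the proved
`e^{-M/2}` instance it holds with rate `e^{-M/120}` (`MRT2015.A2With.theorem17With`).

Consequently this fact is neither to be discharged as stated nor split further; the implications
`…_of_propA3` below and in the importing files remain valid deductions from the printed statement.

## References
* K. Matomäki, M. Radziwiłł, T. Tao, Algebra & Number Theory 9 (2015), 2167–2196; arXiv:1503.05121:
  Appendix A, Theorem A.2, the Parseval display, Proposition A.3 and its proof, Lemma A.4.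
  [cite: MatomakiRadziwillTao2015, Appendix A, Proposition A.3]
* K. Matomäki, M. Radziwiłł, Ann. of Math. 183 (2016), Proposition 1 and §8.

## Design choices
* Same renderings as the vendored Theorem A.2: `I : SieveIntervalSystem η X₀` for the interval system
  with (A-1), (A-2) and the cutoff `J`; `n ∈ 𝒮` is `X ≤ n ≤ 2X ∧ I.Mem n` (here the range is the index set
  `Icc ⌈X⌉₊ ⌊2X⌋₊`, as in `Sieve.MatomakiRadziwill2016_prop1`); `M(f;X) = minPretentiousDistSq f X X`;
  `∃ C Xη` after `η ∈ (0, 1/6)` ("`X > X(η)`", implied constant depending on `η`); "for any `T`" is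
  `0 ≤ T`; the middle error term in Halász's form `(1 + M) e^{-M}` (see the docstring of the fact).
* The deduction never unfolds `I.Mem`; it uses only `1 ≤ Q₁ ≤ exp(√(log X₀))` and `0 < P₁`.
-/

noncomputable section

open Finset Real MeasureTheory
open scoped Classical ComplexConjugate

namespace Literature.NumberTheory.LFunctions

open Sieve (SieveIntervalSystem minPretentiousDistSq minPretentiousDistSq_nonneg pretentiousDistSq)

namespace MRT2015

variable {η X₀ : ℝ}

/-- The Dirichlet polynomial of Proposition A.3 on the `1`-line,
`F(1+it) = ∑_{X ≤ n ≤ 2X, n ∈ 𝒮} f(n) n^{-1-it}` (integers of `[X, 2X]` with the typical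
factorisation `I.Mem`). [cite: MatomakiRadziwillTao2015, Appendix A, Proposition A.3] -/
def restrDirichlet (f : ℕ → ℂ) (I : SieveIntervalSystem η X₀) (X t : ℝ) : ℂ :=
  ∑ n ∈ (Icc ⌈X⌉₊ ⌊2 * X⌋₊).filter (fun n : ℕ => I.Mem n),
    f n * (n : ℂ) ^ (-(1 + (t : ℂ) * Complex.I))

/-- The three error terms of Theorem A.2 / Proposition A.3 at `(Q₁, P₁, M, X)`:
`(log Q₁)^{1/3}/P₁^{1/6-η} + (1 + M) e^{-M} + (log X)^{-1/50}` (with the `(1+M)e^{-M}` reading of the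
printed `e^{-M} M`, see `Literature.NumberTheory.LFunctions.MatomakiRadziwillTao2015_theoremA2`).
[cite: MatomakiRadziwillTao2015, Appendix A, Proposition A.3] -/
def errA3 (η L P M X : ℝ) : ℝ :=
  Real.log L ^ (1 / 3 : ℝ) / P ^ (1 / 6 - η) + (1 + M) * Real.exp (-M) + 1 / Real.log X ^ (1 / 50 : ℝ)

end MRT2015

open MRT2015 in
/-- NAMED FACT — **Matomäki–Radziwiłł–Tao 2015, Proposition A.3** (Algebra & Number Theory 9 (2015),
Appendix A; arXiv:1503.05121 §6, Proposition 6.3), with the standing assumptions of Appendix A (an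
interval system `[P_j, Q_j]` with (A-1), (A-2), `Q₁ ≤ exp(√(log X₀))`, `√X ≤ X₀ ≤ X`, and
`𝒮 = {X ≤ n ≤ 2X : n` has a prime factor in each `[P_j, Q_j]`, `j ≤ J}` — the tree's
`I : SieveIntervalSystem η X₀` and `I.Mem`, exactly as in
`Literature.NumberTheory.LFunctions.MatomakiRadziwillTao2015_theoremA2`): "Let `f` be a `1`-bounded
multiplicative function. Let `𝒮` be as above, and let `F(s) = ∑_{X ≤ n ≤ 2X, n ∈ 𝒮} f(n) n^{-s}`.
Then, for any `T`,
`∫_0^T |F(1+it)|² dt ≪ (T/(X/Q₁) + 1) ((log Q₁)^{1/3}/P₁^{1/6-η} + exp(-M(f;X)) M(f;X) + 1/(log X)^{1/50})`."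
Here `M(f; X) = inf_{|t| ≤ X} 𝔻(f, n^{it}; X)²` is `minPretentiousDistSq f X X`.  Renderings: the implied
constant may depend on `η ∈ (0, 1/6)` and `X > X(η)` is large (as in Theorem A.2, which the proposition
serves: `∃ C Xη`); "any `T`" is any `T ≥ 0` (the integral starts at `0`); the middle error term is
vendored as Halász's `(1 + M) e^{-M}`, which dominates the printed `e^{-M} M` — literally read, the
printed bound fails for `f = 1` (`M = 0`, while `F(1) ≍ 1`), and the printed proof begins "we can assume
… `M(f;X) ≥ 1`" (the same remark as for Theorem A.2).  The one-sided range `t ∈ [0, T]` is as printed;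
the bound for `t ∈ [-T, 0]` follows by applying the fact to `conj ∘ f`
(`MRT2015.propA3_twoSided`).  STATUS: the printed proof does not establish this bound for the
`𝒮`-restricted `F` (module docstring, "Status of the named fact"); consumers take the proved schema
instance `MRT2015.propA3With_exp_half_of_vk` (`MatomakiRadziwillTaoT2OfVK.lean`) instead of
`(h : MatomakiRadziwillTao2015_propA3)`.
[cite: MatomakiRadziwillTao2015, Appendix A, Proposition A.3] -/
def MatomakiRadziwillTao2015_propA3 : Prop :=
  ∀ η : ℝ, 0 < η → η < 1 / 6 → ∃ C Xη : ℝ, ∀ (X X₀ T : ℝ) (I : SieveIntervalSystem η X₀)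
    (f : ArithmeticFunction ℂ), f.IsMultiplicative → (∀ n, ‖f n‖ ≤ 1) →
    Xη < X → Real.sqrt X ≤ X₀ → X₀ ≤ X → 0 ≤ T →
    ∫ t in (0 : ℝ)..T, ‖restrDirichlet f I X t‖ ^ 2 ≤
      C * (T / (X / I.Q 1) + 1) * errA3 η (I.Q 1) (I.P 1) (minPretentiousDistSq f X X) X

namespace MRT2015

variable {η X₀ : ℝ}

open Literature.Barriers.Parity (conjFun conjFun_apply isMultiplicative_conjFun)

/-! ### Conjugating the coefficients: the range `t ≤ 0` -/

/-- `‖conj f‖ ≤ 1` when `‖f‖ ≤ 1` (`conjFun` is the conjugate arithmetic function of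
`Literature/Barriers/Parity/ElliottOriginalForm.lean`). [folklore] -/
theorem norm_conjFun_le {f : ArithmeticFunction ℂ} (hf : ∀ n, ‖f n‖ ≤ 1) (n : ℕ) : ‖conjFun f n‖ ≤ 1 := by
  rw [conjFun_apply, Complex.norm_conj]; exact hf n

/-- `conj (n^{s}) = n^{conj s}` for a natural number `n` (a copy, private to this file, of
`Sieve.MatomakiRadziwillL4A.natCast_cpow_conj` / `HuxleyLV.conj_natCast_cpow`, which are not in the
import closure). [folklore] -/
private theorem conj_natCast_cpow (n : ℕ) (s : ℂ) : conj ((n : ℂ) ^ s) = (n : ℂ) ^ (conj s) := by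
  have h := Complex.conj_cpow (n : ℂ) (conj s) (by rw [Complex.natCast_arg]; exact Real.pi_ne_zero.symm)
  rw [Complex.conj_conj, Complex.conj_natCast] at h
  exact h.symm

/-- `𝔻(conj f, n^{it}; x)² = 𝔻(f, n^{-it}; x)²`. [folklore] -/
theorem pretentiousDistSq_conjFun (f : ArithmeticFunction ℂ) (t x : ℝ) :
    pretentiousDistSq (conjFun f) (fun n : ℕ => (n : ℂ) ^ ((t : ℂ) * Complex.I)) x
      = pretentiousDistSq f (fun n : ℕ => (n : ℂ) ^ (((-t : ℝ) : ℂ) * Complex.I)) x := by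
  unfold Sieve.pretentiousDistSq
  refine Finset.sum_congr rfl fun p _ => ?_
  dsimp only
  have h1 : conj ((p : ℂ) ^ (((-t : ℝ) : ℂ) * Complex.I)) = (p : ℂ) ^ ((t : ℂ) * Complex.I) := by
    rw [conj_natCast_cpow]
    congr 1
    rw [map_mul, Complex.conj_ofReal, Complex.conj_I]
    push_cast; ring
  rw [h1, conjFun_apply, ← map_mul, Complex.conj_re]

/-- `M(conj f; X, T) = M(f; X, T)` (the set `|t| ≤ T` is symmetric). [folklore] -/
theorem minPretentiousDistSq_conjFun (f : ArithmeticFunction ℂ) (X T : ℝ) :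
    minPretentiousDistSq (conjFun f) X T = minPretentiousDistSq f X T := by
  unfold Sieve.minPretentiousDistSq
  let e : Set.Icc (-T) T ≃ Set.Icc (-T) T :=
    { toFun := fun t => ⟨-(t : ℝ), by constructor <;> linarith [t.2.1, t.2.2]⟩
      invFun := fun t => ⟨-(t : ℝ), by constructor <;> linarith [t.2.1, t.2.2]⟩
      left_inv := fun t => by ext; simp
      right_inv := fun t => by ext; simp }
  rw [← Equiv.iInf_comp e.symm]
  refine iInf_congr fun t => ?_
  change pretentiousDistSq (conjFun f) (fun n : ℕ => (n : ℂ) ^ ((((-(t : ℝ) : ℝ)) : ℂ) * Complex.I)) X = _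
  rw [pretentiousDistSq_conjFun]
  simp

/-- `F_{conj f}(1+it) = conj F_f(1-it)`. [folklore] -/
theorem restrDirichlet_conjFun (f : ArithmeticFunction ℂ) (I : SieveIntervalSystem η X₀) (X t : ℝ) :
    restrDirichlet (conjFun f) I X t = conj (restrDirichlet f I X (-t)) := by
  unfold restrDirichlet
  rw [map_sum]
  refine Finset.sum_congr rfl fun n _ => ?_
  rw [map_mul, conjFun_apply, conj_natCast_cpow]
  congr 2
  simp only [map_neg, map_add, map_one, map_mul, Complex.conj_ofReal, Complex.conj_I]
  push_cast; ring

/-- `|F_{conj f}(1+it)| = |F_f(1-it)|`. [folklore] -/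
theorem norm_restrDirichlet_conjFun (f : ArithmeticFunction ℂ) (I : SieveIntervalSystem η X₀) (X t : ℝ) :
    ‖restrDirichlet (conjFun f) I X t‖ = ‖restrDirichlet f I X (-t)‖ := by
  rw [restrDirichlet_conjFun, Complex.norm_conj]

/-- `t ↦ n^{-(1+it)}` is continuous (for `n = 0` it is the constant `0`). [folklore] -/
theorem continuous_natCast_cpow_neg (n : ℕ) :
    Continuous fun t : ℝ => (n : ℂ) ^ (-(1 + (t : ℂ) * Complex.I)) := by
  rcases Nat.eq_zero_or_pos n with rfl | hn
  · have : (fun t : ℝ => ((0 : ℕ) : ℂ) ^ (-(1 + (t : ℂ) * Complex.I))) = fun _ => 0 := by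
      funext t
      rw [Nat.cast_zero, Complex.zero_cpow]
      intro h
      have := congrArg Complex.re h
      simp at this
    rw [this]
    exact continuous_const
  · have hn' : (n : ℂ) ≠ 0 := by exact_mod_cast hn.ne'
    exact Continuous.const_cpow (by fun_prop) (Or.inl hn')

/-- `t ↦ F(1+it)` is continuous. [folklore] -/
theorem continuous_restrDirichlet (f : ℕ → ℂ) (I : SieveIntervalSystem η X₀) (X : ℝ) :
    Continuous (restrDirichlet f I X) := by
  unfold restrDirichlet
  exact continuous_finsetSum _ fun n _ => continuous_const.mul (continuous_natCast_cpow_neg n)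

/-- The error terms are nonnegative for `Q₁ ≥ 1`, `P₁ > 0`, `M ≥ 0`, `X ≥ 1`. [folklore] -/
theorem errA3_nonneg {η L P M X : ℝ} (hL : 1 ≤ L) (hP : 0 < P) (hM : 0 ≤ M) (hX : 1 ≤ X) :
    0 ≤ errA3 η L P M X := by
  unfold errA3
  have h1 : 0 ≤ Real.log L := Real.log_nonneg hL
  have h2 : 0 ≤ Real.log X := Real.log_nonneg hX
  positivity

/-- **Proposition A.3, two-sided**: under the fact, for `X > X(η)`, `T ≥ 0`,
`∫_0^T (|F(1+it)|² + |F(1-it)|²) dt ≤ 2C (T/(X/Q₁) + 1) E`, by applying the printed one-sided bound to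
`f` and to `conj ∘ f` (same `𝒮`, same `M`, `|F_{conj f}(1+it)| = |F_f(1-it)|`).
[cite: MatomakiRadziwillTao2015, Appendix A, Proposition A.3] -/
theorem propA3_twoSided (hA3 : MatomakiRadziwillTao2015_propA3) {η : ℝ} (hη : 0 < η) (hη' : η < 1 / 6) :
    ∃ C Xη : ℝ, 0 ≤ C ∧ ∀ (X X₀ T : ℝ) (I : SieveIntervalSystem η X₀) (f : ArithmeticFunction ℂ),
      f.IsMultiplicative → (∀ n, ‖f n‖ ≤ 1) →
      Xη < X → Real.sqrt X ≤ X₀ → X₀ ≤ X → 0 ≤ T →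
      ∫ t in (0 : ℝ)..T, (‖restrDirichlet f I X t‖ ^ 2 + ‖restrDirichlet f I X (-t)‖ ^ 2) ≤
        2 * C * (T / (X / I.Q 1) + 1) * errA3 η (I.Q 1) (I.P 1) (minPretentiousDistSq f X X) X := by
  obtain ⟨C, Xη, hC⟩ := hA3 η hη hη'
  refine ⟨max C 0, max Xη 1, le_max_right _ _, ?_⟩
  intro X X₀ T I f hf hf1 hX hsq hX₀ hT
  have hXη : Xη < X := lt_of_le_of_lt (le_max_left _ _) hX
  have hX1 : 1 ≤ X := (le_max_right _ _).trans hX.le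
  have hX0 : 0 < X := by linarith
  have hQ1 : 1 ≤ I.Q 1 := I.one_le_Q hη (by linarith) le_rfl
  have hQ0 : 0 < I.Q 1 := by linarith
  have hP0 : 0 < I.P 1 := I.pos_P 1 le_rfl
  set E := errA3 η (I.Q 1) (I.P 1) (minPretentiousDistSq f X X) X with hE
  have hE0 : 0 ≤ E := errA3_nonneg hQ1 hP0 (minPretentiousDistSq_nonneg hf1 X hX0.le) hX1
  have hfac : 0 ≤ T / (X / I.Q 1) + 1 := by positivity
  -- the printed bound for `f` and for `conj f`
  have h1 := hC X X₀ T I f hf hf1 hXη hsq hX₀ hT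
  have h2 := hC X X₀ T I (conjFun f) (isMultiplicative_conjFun hf) (norm_conjFun_le hf1) hXη hsq hX₀ hT
  rw [minPretentiousDistSq_conjFun] at h2
  simp_rw [norm_restrDirichlet_conjFun] at h2
  have hCle : C * (T / (X / I.Q 1) + 1) * E ≤ max C 0 * (T / (X / I.Q 1) + 1) * E :=
    mul_le_mul_of_nonneg_right (mul_le_mul_of_nonneg_right (le_max_left _ _) hfac) hE0
  have i1 : IntervalIntegrable (fun t => ‖restrDirichlet f I X t‖ ^ 2) volume 0 T :=
    ((continuous_restrDirichlet f I X).norm.pow 2).intervalIntegrable _ _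
  have i2 : IntervalIntegrable (fun t => ‖restrDirichlet f I X (-t)‖ ^ 2) volume 0 T :=
    (((continuous_restrDirichlet f I X).comp continuous_neg).norm.pow 2).intervalIntegrable _ _
  rw [intervalIntegral.integral_add i1 i2]
  change (∫ t in (0 : ℝ)..T, ‖restrDirichlet f I X t‖ ^ 2)
      + (∫ t in (0 : ℝ)..T, ‖restrDirichlet f I X (-t)‖ ^ 2) ≤ 2 * max C 0 * (T / (X / I.Q 1) + 1) * E
  linarith

/-! ### Theorem A.2 from Proposition A.3 -/

open Parseval in
/-- The coefficients `a_n = f(n) 1_𝒮(n)` fed to the Parseval bound reproduce the short sums of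
Theorem A.2. [folklore] -/
theorem shortSumA2_eq_sum_filter (f : ℕ → ℂ) (I : SieveIntervalSystem η X₀) (X h x : ℝ) :
    shortSumA2 f I X h x = ∑ m ∈ (Icc ⌈x⌉₊ ⌊x + h⌋₊).filter (fun m : ℕ => X ≤ m ∧ (m : ℝ) ≤ 2 * X),
      (if I.Mem m then f m else 0) := by
  rw [shortSumA2, restrSum, ← Finset.sum_filter, Finset.filter_filter]
  refine Finset.sum_congr (Finset.filter_congr fun n _ => ?_) fun _ _ => rfl
  tauto

open Parseval in
/-- … and their Dirichlet polynomial over `[X, 2X]` is `F(1+it)`. [folklore] -/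
theorem Apoly_eq_restrDirichlet (f : ℕ → ℂ) (I : SieveIntervalSystem η X₀) (X t : ℝ) :
    Apoly X (fun m => if I.Mem m then f m else 0) t = restrDirichlet f I X t := by
  rw [Apoly, suppS, restrDirichlet, Finset.sum_filter]
  refine Finset.sum_congr rfl fun n _ => ?_
  split_ifs <;> simp

open Parseval in
/-- **Theorem A.2 for `1 ≤ h ≤ X` from Proposition A.3** (the heart of the deduction): the Parseval
bound `meanSquare_shortAvg_le` applied to `a_n = f(n) 1_𝒮(n)`, with the two mean values controlled by
the two-sided Proposition A.3: `∫_0^{X/h} B ≤ 2C₃ (Q₁/h + 1) E ≤ 4 C₃ E` and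
`(X/h)/T ∫_T^{2T} B ≤ 2C₃ (2Q₁/h + (X/h)/T) E ≤ 6 C₃ E` for `T ≥ X/h` (using `Q₁ ≤ h`).
[cite: MatomakiRadziwillTao2015, Appendix A, Theorem A.2] -/
theorem theoremA2_core (hA3 : MatomakiRadziwillTao2015_propA3) {η : ℝ} (hη : 0 < η) (hη' : η < 1 / 6) :
    ∃ C Xη : ℝ, 0 ≤ C ∧ ∀ (X X₀ h : ℝ) (I : SieveIntervalSystem η X₀) (f : ArithmeticFunction ℂ),
      f.IsMultiplicative → (∀ n, ‖f n‖ ≤ 1) →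
      Xη < X → 1 ≤ h → h ≤ X → Real.sqrt X ≤ X₀ → X₀ ≤ X → I.Q 1 ≤ h →
      1 / X * ∫ x in X..(2 * X), ‖(h : ℂ)⁻¹ * shortSumA2 f I X h x‖ ^ 2 ≤
        C * errA3 η (I.Q 1) (I.P 1) (minPretentiousDistSq f X X) X := by
  obtain ⟨C₃, X₃, hC₃, h3⟩ := propA3_twoSided hA3 hη hη'
  obtain ⟨Cp, hCp, hP⟩ := meanSquare_shortAvg_le
  refine ⟨10 * Cp * C₃, max X₃ 1, by positivity, ?_⟩
  intro X X₀ h I f hf hf1 hX hh hhX hsq hX₀ hQh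
  have hX₃ : X₃ < X := lt_of_le_of_lt (le_max_left _ _) hX
  have hX1 : 1 ≤ X := (le_max_right _ _).trans hX.le
  have hX0 : 0 < X := by linarith
  have hh0 : 0 < h := by linarith
  have hQ1 : 1 ≤ I.Q 1 := I.one_le_Q hη (by linarith) le_rfl
  have hQ0 : 0 < I.Q 1 := by linarith
  have hP0 : 0 < I.P 1 := I.pos_P 1 le_rfl
  set E := errA3 η (I.Q 1) (I.P 1) (minPretentiousDistSq f X X) X with hE
  have hE0 : 0 ≤ E := errA3_nonneg hQ1 hP0 (minPretentiousDistSq_nonneg hf1 X hX0.le) hX1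
  set a : ℕ → ℂ := fun m => if I.Mem m then f m else 0 with ha_def
  have ha : ∀ m, ‖a m‖ ≤ 1 := fun m => by
    simp only [ha_def]; split_ifs
    · exact hf1 m
    · simp
  set U := X / h with hU
  have hU0 : 0 < U := by positivity
  have hUQ : U / (X / I.Q 1) = I.Q 1 / h := by rw [hU]; field_simp
  have hQh1 : I.Q 1 / h ≤ 1 := by rw [div_le_one hh0]; exact hQh
  -- the Parseval bound
  have hPar := hP X h a hX1 hh hhX ha
  have hlhs : (fun x => ‖(h : ℂ)⁻¹ * ∑ m ∈ (Icc ⌈x⌉₊ ⌊x + h⌋₊).filter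
      (fun m : ℕ => X ≤ m ∧ (m : ℝ) ≤ 2 * X), a m‖ ^ 2)
      = fun x => ‖(h : ℂ)⁻¹ * shortSumA2 f I X h x‖ ^ 2 := by
    funext x; rw [shortSumA2_eq_sum_filter]
  rw [hlhs] at hPar
  have hB : ∀ t, Bsq X a t = ‖restrDirichlet f I X t‖ ^ 2 + ‖restrDirichlet f I X (-t)‖ ^ 2 := by
    intro t; simp only [Bsq, ha_def, Apoly_eq_restrDirichlet]
  -- the mean value over `[0, U]`
  have hI : ∫ t in (0 : ℝ)..U, Bsq X a t ≤ 4 * C₃ * E := by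
    simp_rw [hB]
    have hh3 := h3 X X₀ U I f hf hf1 hX₃ hsq hX₀ hU0.le
    rw [hUQ] at hh3
    refine hh3.trans ?_
    have : 2 * C₃ * (I.Q 1 / h + 1) * E ≤ 2 * C₃ * 2 * E := by
      refine mul_le_mul_of_nonneg_right ?_ hE0
      exact mul_le_mul_of_nonneg_left (by linarith) (by positivity)
    linarith
  -- the `sup` term
  have hS : Ssup X a U ≤ 6 * C₃ * E := by
    haveI : Nonempty (Set.Ici U) := ⟨⟨U, Set.self_mem_Ici⟩⟩
    refine ciSup_le fun T' => ?_
    obtain ⟨T, hTmem⟩ := T'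
    have hT : U ≤ T := hTmem
    have hT0 : 0 < T := hU0.trans_le hT
    change U / T * ∫ t in T..2 * T, Bsq X a t ≤ 6 * C₃ * E
    have hcont : Continuous (Bsq X a) := continuous_Bsq X hX1 a
    have step1 : ∫ t in T..2 * T, Bsq X a t ≤ ∫ t in (0 : ℝ)..2 * T, Bsq X a t :=
      intervalIntegral.integral_mono_interval hT0.le (by linarith) le_rfl
        (ae_of_all _ fun t => Bsq_nonneg X a t) (hcont.intervalIntegrable _ _)
    have step2 : ∫ t in (0 : ℝ)..2 * T, Bsq X a t ≤ 2 * C₃ * (2 * T / (X / I.Q 1) + 1) * E := by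
      simp_rw [hB]
      exact h3 X X₀ (2 * T) I f hf hf1 hX₃ hsq hX₀ (by linarith)
    have hfac : U / T * (2 * T / (X / I.Q 1) + 1) ≤ 3 := by
      have e1 : U / T * (2 * T / (X / I.Q 1)) = 2 * (I.Q 1 / h) := by
        rw [hU]; field_simp
      have e2 : U / T ≤ 1 := by rw [div_le_one hT0]; exact hT
      rw [mul_add, e1, mul_one]
      linarith
    calc U / T * ∫ t in T..2 * T, Bsq X a t
        ≤ U / T * (2 * C₃ * (2 * T / (X / I.Q 1) + 1) * E) :=
          mul_le_mul_of_nonneg_left (step1.trans step2) (by positivity)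
      _ = (U / T * (2 * T / (X / I.Q 1) + 1)) * (2 * C₃ * E) := by ring
      _ ≤ 3 * (2 * C₃ * E) := mul_le_mul_of_nonneg_right hfac (by positivity)
      _ = 6 * C₃ * E := by ring
  calc 1 / X * ∫ x in X..(2 * X), ‖(h : ℂ)⁻¹ * shortSumA2 f I X h x‖ ^ 2
      ≤ Cp * ((∫ t in (0 : ℝ)..X / h, Bsq X a t) + Ssup X a (X / h)) := hPar
    _ ≤ Cp * (4 * C₃ * E + 6 * C₃ * E) := mul_le_mul_of_nonneg_left (add_le_add hI hS) hCp.le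
    _ = 10 * Cp * C₃ * E := by ring

/-- For `h ≥ X` the window `[x, x+h] ∩ [X, 2X]` (`x ≥ X`) no longer depends on `h`:
`shortSumA2 f I X h x = shortSumA2 f I X X x`. [folklore] -/
theorem shortSumA2_of_le {f : ℕ → ℂ} (I : SieveIntervalSystem η X₀) {X h x : ℝ}
    (hx : X ≤ x) (hh : X ≤ h) : shortSumA2 f I X h x = shortSumA2 f I X X x := by
  unfold shortSumA2 restrSum
  refine Finset.sum_congr ?_ fun _ _ => rfl
  ext n
  simp only [Finset.mem_filter, Finset.mem_Icc]
  constructor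
  · rintro ⟨⟨h1, -⟩, h3, h4, h5⟩
    refine ⟨⟨h1, Nat.le_floor ?_⟩, h3, h4, h5⟩
    linarith
  · rintro ⟨⟨h1, -⟩, h3, h4, h5⟩
    refine ⟨⟨h1, Nat.le_floor ?_⟩, h3, h4, h5⟩
    linarith

/-- `exp(√(log X)) ≤ X` for `X ≥ e`. [folklore] -/
theorem exp_sqrt_log_le {X : ℝ} (hX : Real.exp 1 ≤ X) : Real.exp (Real.sqrt (Real.log X)) ≤ X := by
  have hX0 : 0 < X := (Real.exp_pos 1).trans_le hX
  have hlog : 1 ≤ Real.log X := by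
    rw [← Real.log_exp 1]; exact Real.log_le_log (Real.exp_pos 1) hX
  calc Real.exp (Real.sqrt (Real.log X)) ≤ Real.exp (Real.log X) := by
        refine Real.exp_le_exp.2 ?_
        rw [Real.sqrt_le_left (by linarith)]
        nlinarith
    _ = X := Real.exp_log hX0

end MRT2015

open MRT2015 in
/-- **Matomäki–Radziwiłł–Tao 2015, Theorem A.2 from Proposition A.3** (Algebra & Number Theory 9
(2015), Appendix A: "Theorem A.2 now follows immediately from the following variant of [MR]",
i.e. from the Parseval bound and Proposition A.3).  Proof: for `h ≤ X`, `theoremA2_core` (the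
Parseval bound of `MatomakiRadziwillTaoParseval.lean` for `a_n = f(n)1_𝒮(n)` and the two-sided
Proposition A.3), followed by `(log Q₁)^{1/3} ≤ (log h)^{1/3}` (`Q₁ ≤ h`); for `h > X` the restricted
window sum equals the one for `h = X` (`shortSumA2_of_le`), `h⁻² ≤ X⁻²`, `Q₁ ≤ exp(√(log X₀)) ≤ X`, and
`(log X)^{1/3} ≤ (log h)^{1/3}`.  The constant is `10 C_P C₃` and `X(η) = max(X₃(η), 3)`.
[cite: MatomakiRadziwillTao2015, Appendix A, Theorem A.2] -/
theorem MatomakiRadziwillTao2015_theoremA2_of_propA3 (hA3 : MatomakiRadziwillTao2015_propA3) :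
    MatomakiRadziwillTao2015_theoremA2 := by
  intro η hη hη'
  obtain ⟨C, Xc, hC0, hcore⟩ := theoremA2_core hA3 hη hη'
  refine ⟨C, max Xc 3, ?_⟩
  intro X X₀ h I f hf hf1 hX hh3 hsq hX₀ hQh
  have hXc : Xc < X := lt_of_le_of_lt (le_max_left _ _) hX
  have hX3 : 3 < X := lt_of_le_of_lt (le_max_right _ _) hX
  have hX1 : 1 ≤ X := by linarith
  have hX0 : 0 < X := by linarith
  have hQ1 : 1 ≤ I.Q 1 := I.one_le_Q hη (by linarith) le_rfl
  have hQ0 : 0 < I.Q 1 := by linarith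
  have hP0 : 0 < I.P 1 := I.pos_P 1 le_rfl
  set M := minPretentiousDistSq f X X with hM
  have hM0 : 0 ≤ M := minPretentiousDistSq_nonneg hf1 X hX0.le
  -- monotonicity of the first error term in its logarithm
  have hmono : ∀ {L : ℝ}, I.Q 1 ≤ L →
      errA3 η (I.Q 1) (I.P 1) M X ≤ (1 + M) * Real.exp (-M)
        + Real.log L ^ (1 / 3 : ℝ) / I.P 1 ^ (1 / 6 - η) + 1 / Real.log X ^ (1 / 50 : ℝ) := by
    intro L hL
    have h1 : Real.log (I.Q 1) ^ (1 / 3 : ℝ) ≤ Real.log L ^ (1 / 3 : ℝ) :=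
      Real.rpow_le_rpow (Real.log_nonneg hQ1) (Real.log_le_log hQ0 hL) (by norm_num)
    have h2 : Real.log (I.Q 1) ^ (1 / 3 : ℝ) / I.P 1 ^ (1 / 6 - η) ≤ Real.log L ^ (1 / 3 : ℝ) / I.P 1 ^ (1 / 6 - η) :=
      div_le_div_of_nonneg_right h1 (Real.rpow_pos_of_pos hP0 _).le
    unfold errA3; linarith
  rcases le_or_gt h X with hhX | hhX
  · -- `h ≤ X`
    have h1 := hcore X X₀ h I f hf hf1 hXc (by linarith) hhX hsq hX₀ hQh
    exact h1.trans (mul_le_mul_of_nonneg_left (hmono hQh) hC0)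
  · -- `h > X`: reduce to `h = X`
    have hX₀0 : 0 < X₀ := (Real.sqrt_pos.2 hX0).trans_le hsq
    have hQX : I.Q 1 ≤ X := by
      calc I.Q 1 ≤ Real.exp (Real.sqrt (Real.log X₀)) := I.Q_one_le hη (by linarith)
        _ ≤ Real.exp (Real.sqrt (Real.log X)) := by
            refine Real.exp_le_exp.2 (Real.sqrt_le_sqrt (Real.log_le_log hX₀0 hX₀))
        _ ≤ X := exp_sqrt_log_le (le_trans (by have := Real.exp_one_lt_d9; norm_num at this; linarith) hX3.le)
    have h1 := hcore X X₀ X I f hf hf1 hXc hX1 le_rfl hsq hX₀ hQX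
    -- compare the integrands pointwise on `(X, 2X]`
    have hptw : ∀ x ∈ Set.Ioc X (2 * X),
        ‖(h : ℂ)⁻¹ * shortSumA2 f I X h x‖ ^ 2 ≤ ‖(X : ℂ)⁻¹ * shortSumA2 f I X X x‖ ^ 2 := by
      intro x hx
      rw [shortSumA2_of_le I hx.1.le hhX.le, norm_mul, norm_mul, norm_inv, norm_inv,
        Complex.norm_real, Complex.norm_real, Real.norm_eq_abs, Real.norm_eq_abs,
        abs_of_pos (hX0.trans hhX), abs_of_pos hX0]
      have : h⁻¹ ≤ X⁻¹ := (inv_le_inv₀ (hX0.trans hhX) hX0).2 hhX.le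
      gcongr
    have hint : ∀ {k : ℝ}, 0 < k → IntervalIntegrable (fun x => ‖(k : ℂ)⁻¹ * shortSumA2 f I X k x‖ ^ 2)
        volume X (2 * X) := by
      intro k hk
      have e : (fun x => ‖(k : ℂ)⁻¹ * shortSumA2 f I X k x‖ ^ 2) = fun x => k⁻¹ ^ 2 * sqIntegrand f I X k x := by
        funext x
        rw [sqIntegrand, norm_mul, mul_pow, norm_inv, Complex.norm_real, Real.norm_eq_abs, abs_of_pos hk]
      rw [e]
      exact (intervalIntegrable_sqIntegrand hf1 I X hk.le X (2 * X)).const_mul _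
    have hle : ∫ x in X..(2 * X), ‖(h : ℂ)⁻¹ * shortSumA2 f I X h x‖ ^ 2
        ≤ ∫ x in X..(2 * X), ‖(X : ℂ)⁻¹ * shortSumA2 f I X X x‖ ^ 2 := by
      rw [intervalIntegral.integral_of_le (by linarith), intervalIntegral.integral_of_le (by linarith)]
      refine setIntegral_mono_on ?_ ?_ measurableSet_Ioc hptw
      · exact ((hint (hX0.trans hhX)).1)
      · exact ((hint hX0).1)
    calc 1 / X * ∫ x in X..(2 * X), ‖(h : ℂ)⁻¹ * shortSumA2 f I X h x‖ ^ 2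
        ≤ 1 / X * ∫ x in X..(2 * X), ‖(X : ℂ)⁻¹ * shortSumA2 f I X X x‖ ^ 2 :=
          mul_le_mul_of_nonneg_left hle (by positivity)
      _ ≤ C * errA3 η (I.Q 1) (I.P 1) M X := h1
      _ ≤ C * ((1 + M) * Real.exp (-M) + Real.log h ^ (1 / 3 : ℝ) / I.P 1 ^ (1 / 6 - η)
            + 1 / Real.log X ^ (1 / 50 : ℝ)) :=
          mul_le_mul_of_nonneg_left (hmono (hQX.trans hhX.le)) hC0

end Literature.NumberTheory.LFunctions

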